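import Summits.BirchSwinnertonDyer.BirchSwinnertonDyer.Theorems.QuadraticBranchSignedControlPlusEtaNonsurjSexticTwistGalois
import Summits.BirchSwinnertonDyer.BirchSwinnertonDyer.Theorems.QuadraticBranchSignedControlPlusEtaNonsurjQuarticTwistDoor
import Summits.BirchSwinnertonDyer.BirchSwinnertonDyer.Theorems.QuadraticBranchSignedControlPlusEtaNonsurjMultiplicativeFrobeniusTrace
import Summits.BirchSwinnertonDyer.Rank1Residual.X12.GoodTwistRecords
import Literature.NumberTheory.Congruences.QuadraticCharactersMinusThreeAndFive
import HarnessLib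

/-!
# Route `QuadraticBranchSignedControl` (rung K8, cell `bsd-potss`): crux stmt-BirchSwinnertonDyer-19606
# `PlusEtaMainConjectureNonsurj` — THE SEXTIC DOOR, PART II: a mod-`p` anchor with `j = 0` (a sextic twist of `y² = x³ + 1`) reads
# `a_ℓ(V)² ≡ t²` or `a_ℓ(V)² ∈ {x², (x − t)²}` with `x² − tx + t² = 3ℓ` (`t = a_ℓ(E₀')`, `p ≡ 2 (mod 3)`, `ℓ ≡ 1 (mod 3)`)

WHY. See Part I (`…SexticTwistGalois`). Along the `ℚ̄`-isomorphism `A ≅ E₀' : y² = x³ + 1` of Part I an arithmetic Frobenius `σ` at a prime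
`ℓ ≡ 1 (mod 3)` (which FIXES `ζ₃`: `−3` is a square mod `ℓ`) is transported up to an automorphism `θ` of `E₀'` with `θ³ = ±1` commuting with
`σ`; in a frame of `E₀'[p]`: `M_θ³ = ±1`, `M_θ M_σ = M_σ M_θ`, `tr M_σ = a_ℓ(E₀') = t`, `det M_σ = ℓ`; over `𝔽_p` with `p ≡ 2 (mod 3)` (`−3` a
non-square) Part I's `2 × 2` lemmas give `M_θ = ∓1` or `M_θ² = ±M_θ − 1`, and the `σ`-matrix on `A[p] ≅ V[p]` is `±M_σ`, `−M_θ²M_σ` or `M_θ²M_σ`,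
of trace `±t` or `±(x − t)` with `x² − tx + t² = 3ℓ`. This is Gauss's theorem «`a_ℓ ∈ {±L, ±(L + 9M)/2, ±(L − 9M)/2}`, `4ℓ = L² + 27M²`» for the
sextic twists of `y² = x³ + 1` (Ireland–Rosen 18 §3), read modulo `p` through the congruence — in the form the kernel can check by `decide`.

* §4 **`sq_frobeniusTrace_of_modPCongruent_of_j_eq_zero`** (the door); §5 `not_dvd_discOf_E0'`, **`not_modPCongruent_of_j_eq_zero_of_counts`**
  (record form: one prime `ℓ ≡ 1 (3)` with `a_ℓ(V)² ∉ {t²} ∪ {x², (x − t)² : x² − tx + t² = 3ℓ}` (mod `p`) excludes every `j = 0` anchor).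
  Application: `…UncongruentRecordsEleven03` row `4P` of `X_ns⁺(11)` (`K_V = ℚ(√−3)`; witness `ℓ = 31`: `a₃₁(V) = −3`, `t = −4`, door set
  `{t²} ∪ {x², (x−t)²} = {5, 0} ∌ 9 (mod 11)`).

HONEST FRAMING (cell `bsd-potss`, run/shared/lean/pub/bsd-potss/; FULL-BSD rank ≤ 1 programme): TOOL THEOREMS ONLY (no definition,
no named fact, no `sorry`, axioms standard). Nothing is booked; crux 19606 stays OPEN. Seat `bsd-potss-k8eta-c2` g16 (prover),
`--supports stmt-BirchSwinnertonDyer-19606`. `E₀' = [0,0,0,0,1]` (`36a1`): `Δ ≠ 0` / global minimality REUSED from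
`Summit.BirchSwinnertonDyer.Rank1Residual.X12.Records.isElliptic_cremona36a1` / `isGloballyMinimal_cremona36a1`.

References: [SilvermanAEC2009] X.5 Prop. 5.4 (iii), Cor. 5.4.1, III.10; [IrelandRosen1990] Ch. 18 §3 Thm. 4; [HardyWright2008] Thm. 96
(`(−3/ℓ)`); [Serre1981] §8.1.
-/

set_option autoImplicit false
set_option linter.dupNamespace false

noncomputable section

open scoped Classical NumberField

open Field IsDedekindDomain NumberField WeierstrassCurve Literature.NumberTheory.EllipticCurves
  Literature.NumberTheory.GaloisRepresentations Rat.HeightOneSpectrum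
open Literature.NumberTheory.EllipticCurves.DeuringLadic
open Summit.BirchSwinnertonDyer.Rank1Residual.O6 (ModPCongruent)
open Summit.BirchSwinnertonDyer.BirchSwinnertonDyer.Rank1Residual.IntModel (integralModelInt_eq_of_map_eq map_mk_int minimalDiscriminantInt_eq)
open scoped Matrix
open Literature.NumberTheory.EllipticCurves.Rank1Residual.X11RankOneCertificates (discOf countPoints)
open Summit.BirchSwinnertonDyer.Rank1Residual.X12.Records (isElliptic_cremona36a1 isGloballyMinimal_cremona36a1)
open Literature.NumberTheory.Congruences.SmallQuadraticResidues (isSquare_neg_three_iff not_isSquare_neg_three)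

namespace Summit.BirchSwinnertonDyer.BirchSwinnertonDyer.Theorems.EtaCartanField

/-! ## §4 The sextic door -/

/-- **THE SEXTIC DOOR.** Let `p ≡ 2 (mod 3)`, `p ≥ 5`, be prime, `V/ℚ` globally minimal and `A/ℚ` an elliptic curve with `j(A) = 0` and
`V[p] ≅ A[p]` (`ModPCongruent V A p`). Then at every prime `ℓ ≡ 1 (mod 3)`, `ℓ ≠ p`, of good reduction for `V`, with `t = a_ℓ(E₀')`,
`E₀' : y² = x³ + 1` (`36a1`): `a_ℓ(V)² ≡ t² (mod p)`, or there is `x ∈ 𝔽_p` with `x² − tx + t² = 3ℓ` and `a_ℓ(V)² ≡ x²` or `a_ℓ(V)² ≡ (x − t)²`.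
(An arithmetic Frobenius `σ` at `ℓ` fixes `ζ₆` since `ℓ ≡ 1 (mod 3)`; along the `ℚ̄`-isomorphism `A ≅ E₀'` of Part I it is transported up to
an automorphism `θ` with `θ³ = ±1`; in a frame of `E₀'[p]` the matrices `M_θ`, `M_σ` commute, `tr M_σ = t`, `det M_σ = ℓ`, and `−3` is a
non-square mod `p`; Part I §1.) This is Gauss's theorem «`a_ℓ ∈ {±L, ±(L ± 9M)/2}`, `4ℓ = L² + 27M²`» for the sextic twists of `y² = x³ + 1`,
read modulo `p` through the congruence. [cite: SilvermanAEC2009, X.5 Prop. 5.4 and Cor. 5.4.1] [cite: IrelandRosen1990, Ch. 18 §3 Thm. 4] -/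
theorem sq_frobeniusTrace_of_modPCongruent_of_j_eq_zero (V : WeierstrassCurve ℚ) [V.IsElliptic] [V.IsGloballyMinimal]
    (p : ℕ) [Fact p.Prime] (hp3 : p % 3 = 2) (hp5 : 5 ≤ p) {A : WeierstrassCurve ℚ} [A.IsElliptic] (hVA : ModPCongruent V A p)
    (hj : A.j = 0) (ℓ : ℕ) [hℓ : Fact ℓ.Prime] (hℓ3 : ℓ % 3 = 1) (hℓp : ℓ ≠ p) (hgoodV : V.HasGoodReductionAtPrime ℓ) :
    haveI : (⟨0, 0, 0, 0, 1⟩ : WeierstrassCurve ℚ).IsElliptic := isElliptic_cremona36a1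
    haveI : (⟨0, 0, 0, 0, 1⟩ : WeierstrassCurve ℚ).IsGloballyMinimal := isGloballyMinimal_cremona36a1
    (p : ℤ) ∣ V.frobeniusTrace ℓ ^ 2 - (⟨0, 0, 0, 0, 1⟩ : WeierstrassCurve ℚ).frobeniusTrace ℓ ^ 2 ∨
      ∃ x : ZMod p, x ^ 2 - ((⟨0, 0, 0, 0, 1⟩ : WeierstrassCurve ℚ).frobeniusTrace ℓ : ZMod p) * x +
          ((⟨0, 0, 0, 0, 1⟩ : WeierstrassCurve ℚ).frobeniusTrace ℓ : ZMod p) ^ 2 = 3 * (ℓ : ZMod p) ∧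
        ((V.frobeniusTrace ℓ : ZMod p) ^ 2 = x ^ 2 ∨
          (V.frobeniusTrace ℓ : ZMod p) ^ 2 = (x - ((⟨0, 0, 0, 0, 1⟩ : WeierstrassCurve ℚ).frobeniusTrace ℓ : ZMod p)) ^ 2) := by
  haveI : (⟨0, 0, 0, 0, 1⟩ : WeierstrassCurve ℚ).IsElliptic := isElliptic_cremona36a1
  haveI : (⟨0, 0, 0, 0, 1⟩ : WeierstrassCurve ℚ).IsGloballyMinimal := isGloballyMinimal_cremona36a1
  set E₀ : WeierstrassCurve ℚ := ⟨0, 0, 0, 0, 1⟩ with hE₀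
  letI : Module (ZMod p) (V.geomTorsion p) := AddSubgroup.torsionBy.zmodModule
  letI : Module (ZMod p) (A.geomTorsion p) := AddSubgroup.torsionBy.zmodModule
  letI : Module (ZMod p) (E₀.geomTorsion p) := AddSubgroup.torsionBy.zmodModule
  have hℓP : ℓ.Prime := hℓ.out
  have hℓ2 : ℓ ≠ 2 := by intro h; rw [h] at hℓ3; norm_num at hℓ3
  have hℓ3' : ℓ ≠ 3 := by intro h; rw [h] at hℓ3; norm_num at hℓ3
  have hℓ6 : ℓ % 6 = 1 := by
    have hodd : ℓ % 2 = 1 := (Nat.Prime.mod_two_eq_one_iff_ne_two hℓP).mpr hℓ2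
    omega
  have hℓgt3 : 3 < ℓ := by
    have := hℓP.two_le
    by_contra h
    interval_cases ℓ <;> simp_all
  -- `−3` is a non-square mod `p` and a square mod `ℓ`
  have hp6 : p % 6 = 5 := by
    have hp2 : p ≠ 2 := by omega
    have hodd : p % 2 = 1 := (Nat.Prime.mod_two_eq_one_iff_ne_two (Fact.out : p.Prime)).mpr hp2
    omega
  have hnsq : ¬ IsSquare (-3 : ZMod p) := not_isSquare_neg_three hp6
  have hsqℓ : IsSquare (((-3 : ℤ) : ℤ) : ZMod ℓ) := by
    have h := (isSquare_neg_three_iff (p := ℓ) hℓgt3).mpr hℓ6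
    rw [Int.cast_neg, Int.cast_ofNat]; exact h
  -- `s = √−3`, `Z = ζ₆ = (1 + s)/2` and an arithmetic Frobenius at `ℓ` fixing them
  obtain ⟨s, hs⟩ := IsAlgClosed.exists_pow_nat_eq (-3 : AlgebraicClosure ℚ) two_pos
  set Z : AlgebraicClosure ℚ := (1 + s) / 2 with hZdef
  have hZ : Z ^ 2 = Z - 1 := by rw [hZdef]; linear_combination hs / 4
  obtain ⟨v, hv⟩ : ∃ v : HeightOneSpectrum (𝓞 ℚ), (primesEquiv v : ℕ) = ℓ :=
    ⟨primesEquiv.symm ⟨ℓ, hℓP⟩, by rw [Equiv.apply_symm_apply]⟩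
  obtain ⟨𝔓, h𝔓⟩ := v.primesAbove_nonempty
  obtain ⟨σ, hσ⟩ := HeightOneSpectrum.exists_isArithFrobAt_of_mem_primesAbove_holds h𝔓
  have hσs : σ • s = s :=
    smul_eq_self_of_isArithFrobAt hℓP hℓ2 (d := -3)
      (by rw [dvd_neg]; intro h; exact hℓ3' ((Nat.prime_dvd_prime_iff_eq hℓP Nat.prime_three).mp (by exact_mod_cast h)))
      hsqℓ (by rw [hs]; push_cast; ring) hv h𝔓 hσ
  have hσZ : σ • Z = Z := by
    have h2 : σ • (2 : AlgebraicClosure ℚ) = 2 := by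
      rw [← map_ofNat (algebraMap ℚ (AlgebraicClosure ℚ)) 2, smul_algebraMap]
    rw [hZdef, smul_div₀', smul_add, smul_one, hσs, h2]
  -- good reduction of `E₀'` at `ℓ ∤ 6`
  have hgoodE : E₀.HasGoodReductionAtPrime ℓ := by
    refine E₀.hasGoodReductionAtPrime_of_not_dvd ℓ ?_
    have hIE : integralModelInt E₀ = ⟨0, 0, 0, 0, 1⟩ :=
      integralModelInt_eq_of_map_eq _ (by rw [hE₀]; ext <;> simp [WeierstrassCurve.map])
    rw [minimalDiscriminantInt_eq hIE]
    intro h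
    have h432 : (ℓ : ℤ) ∣ 2 ^ 4 * 3 ^ 3 := by
      have : (⟨0, 0, 0, 0, 1⟩ : WeierstrassCurve ℤ).Δ = -(2 ^ 4 * 3 ^ 3) := by
        simp [WeierstrassCurve.Δ, WeierstrassCurve.b₂, WeierstrassCurve.b₄, WeierstrassCurve.b₆, WeierstrassCurve.b₈]
      rw [this, dvd_neg] at h; exact h
    have hℓPi : Prime (ℓ : ℤ) := Nat.prime_iff_prime_int.mp hℓP
    rcases hℓPi.dvd_or_dvd h432 with h2 | h3
    · have h22 : ℓ ∣ 2 := by exact_mod_cast Int.Prime.dvd_pow' hℓP h2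
      exact hℓ2 ((Nat.prime_dvd_prime_iff_eq hℓP Nat.prime_two).mp h22)
    · have h33 : ℓ ∣ 3 := by exact_mod_cast Int.Prime.dvd_pow' hℓP h3
      exact hℓ3' ((Nat.prime_dvd_prime_iff_eq hℓP Nat.prime_three).mp h33)
  -- the `ℚ̄`-isomorphism `A ≅ E₀'` with its sextic Galois behaviour at `σ`, restricted to `p`-torsion
  obtain ⟨ι, hι⟩ := exists_iso_of_j_eq_zero hj hZ
  obtain ⟨θ, hθg, hθ3, hrelι⟩ := hι σ hσZ
  obtain ⟨e₁, he₁⟩ := exists_torsionEquiv_of_addEquiv ι (p : ℤ)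
  obtain ⟨T, hT⟩ := exists_torsionEquiv_of_addEquiv θ (p : ℤ)
  obtain ⟨e₀, he₀⟩ := hVA
  -- a frame of `E₀'[p]`
  obtain ⟨f, Φ, hf, -⟩ := exists_frame_galoisRepTorsion_rat E₀ p
  set MF : Matrix (Fin 2) (Fin 2) (ZMod p) :=
    ((Φ (galoisRepTorsion E₀ p σ) : GL (Fin 2) (ZMod p)) : Matrix (Fin 2) (Fin 2) (ZMod p)) with hMF
  set MT : Matrix (Fin 2) (Fin 2) (ZMod p) :=
    ((Φ (Multiplicative.ofAdd T) : GL (Fin 2) (ZMod p)) : Matrix (Fin 2) (Fin 2) (ZMod p)) with hMT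
  have hfσ : ∀ Q : E₀.geomTorsion p, f (σ • Q) = MF *ᵥ f Q := fun Q => hf (galoisRepTorsion E₀ p σ) Q
  have hfT : ∀ Q : E₀.geomTorsion p, f (T Q) = MT *ᵥ f Q := fun Q => hf (Multiplicative.ofAdd T) Q
  -- `T (σ Q) = σ (T Q)` on torsion, hence `MT MF = MF MT`
  have hTσ : ∀ Q : E₀.geomTorsion p, T (σ • Q) = σ • T Q := fun Q => Subtype.ext (by
    rw [hT]; change θ (σ • (Q : E₀.geomPoints)) = σ • ((T Q : E₀.geomTorsion p) : E₀.geomPoints); rw [hT, hθg σ hσZ])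
  have hMTF : MT * MF = MF * MT := matrix_eq_of_forall_mulVec_eq fun w => by
    obtain ⟨Q, rfl⟩ := f.surjective w
    rw [← Matrix.mulVec_mulVec, ← Matrix.mulVec_mulVec, ← hfσ, ← hfT, hTσ, hfσ, hfT]
  -- traces and determinant of Frobenius
  have htrE : MF.trace = (E₀.frobeniusTrace ℓ : ZMod p) := by
    rw [← trace_eq_matrix_trace f hfσ]; exact E₀.trace_galoisRepTorsion_frobenius_eq p hℓp hgoodE hv h𝔓 hσ
  have hdetE : MF.det = (ℓ : ZMod p) := by
    rw [← det_eq_matrix_det f hfσ]; exact E₀.det_galoisRepTorsion_frobenius_eq p hℓp hgoodE hv h𝔓 hσ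
  have htrV : LinearMap.trace (ZMod p) (V.geomTorsion p) ((galoisRepTorsion V p σ).toAdd.toAddMonoidHom.toZModLinearMap p) =
      (V.frobeniusTrace ℓ : ZMod p) := V.trace_galoisRepTorsion_frobenius_eq p hℓp hgoodV hv h𝔓 hσ
  have htrVA : LinearMap.trace (ZMod p) (V.geomTorsion p) ((galoisRepTorsion V p σ).toAdd.toAddMonoidHom.toZModLinearMap p) =
      LinearMap.trace (ZMod p) (A.geomTorsion p) ((galoisRepTorsion A p σ).toAdd.toAddMonoidHom.toZModLinearMap p) := by
    have h1 := trace_eq_mul_trace_of_twistedIso e₀ (σ := σ) (s := 1) (fun P => by rw [he₀, one_zsmul])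
    rw [Int.cast_one, one_mul] at h1; exact h1
  -- the composite frame `f ∘ e₁` of `A[p]`; `T (e₁ (σ P)) = σ (e₁ P)`
  let f' : A.geomTorsion p ≃+ (Fin 2 → ZMod p) := e₁.trans f
  have hf' : ∀ P, f' P = f (e₁ P) := fun _ => rfl
  have hcoeσ : ∀ P : A.geomTorsion p, ((σ • P : A.geomTorsion p) : A.geomPoints) = σ • (P : A.geomPoints) := fun _ => rfl
  have hrel : ∀ P : A.geomTorsion p, T (e₁ (σ • P)) = σ • e₁ P := fun P => Subtype.ext (by
    rw [hT, he₁, hcoeσ, hrelι]; change σ • ι (P : A.geomPoints) = σ • ((e₁ P : E₀.geomTorsion p) : E₀.geomPoints); rw [he₁])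
  have h5 : ∀ P : A.geomTorsion p, MT *ᵥ f' (σ • P) = MF *ᵥ f' P := fun P => by rw [hf', hf', ← hfT, hrel, hfσ]
  -- `tr(σ | V[p]) = tr(N)` for the matrix `N` through which `σ` acts on `A[p]` in the frame `f'`
  have htrace : ∀ N : Matrix (Fin 2) (Fin 2) (ZMod p), (∀ P : A.geomTorsion p, f' (σ • P) = N *ᵥ f' P) →
      (V.frobeniusTrace ℓ : ZMod p) = N.trace := fun N hN => by
    rw [← htrV, htrVA]; exact trace_eq_matrix_trace f' hN
  rcases hθ3 with h3 | h3
  · -- `θ³ = 1`: `MT³ = 1`; apply §1 to `−MT`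
    have hTTT : ∀ Q : E₀.geomTorsion p, T (T (T Q)) = Q := fun Q => Subtype.ext (by rw [hT, hT, hT, h3])
    have hM3 : MT * MT * MT = 1 := matrix_eq_of_forall_mulVec_eq fun w => by
      obtain ⟨Q, rfl⟩ := f.surjective w
      rw [← Matrix.mulVec_mulVec, ← Matrix.mulVec_mulVec, ← hfT, ← hfT, ← hfT, hTTT, Matrix.one_mulVec]
    have hσ' : ∀ P : A.geomTorsion p, f' (σ • P) = (MT * MT * MF) *ᵥ f' P := fun P => by
      have h6 : f' (σ • P) = MT *ᵥ (MT *ᵥ (MT *ᵥ f' (σ • P))) := by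
        rw [Matrix.mulVec_mulVec, Matrix.mulVec_mulVec, hM3, Matrix.one_mulVec]
      rw [h6, h5, Matrix.mulVec_mulVec, Matrix.mulVec_mulVec]
    have hN3 : (-MT) * (-MT) * (-MT) = -1 := by rw [neg_mul_neg, mul_neg, hM3]
    rcases eq_neg_one_or_of_pow_three_eq_neg_one hN3 hnsq with hN | ⟨hN2, hNtr⟩
    · -- `MT = 1`: `σ` acts through `MF`
      have hMT1 : MT = 1 := by rw [← neg_neg MT, hN, neg_neg]
      left
      rw [← ZMod.intCast_zmod_eq_zero_iff_dvd]; push_cast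
      rw [htrace (MT * MT * MF) hσ', hMT1, one_mul, one_mul, htrE]; ring
    · -- `MT² = −MT − 1`: `σ` acts through `MT² MF = −(MT MF) − MF`, trace `x − t` with `x = tr((−MT) MF)`
      right
      have hNF : (-MT) * MF = MF * (-MT) := by rw [neg_mul, mul_neg, hMTF]
      have key := trace_identity_of_mul_self_eq_sub_one hN2 hNtr hnsq hNF
      refine ⟨((-MT) * MF).trace, ?_, Or.inr ?_⟩
      · rw [← htrE, ← hdetE]; linear_combination key
      · have hMM : MT * MT * MF = (-MT) * MF - MF := by
          rw [show MT * MT = (-MT) * (-MT) by rw [neg_mul_neg], hN2]; noncomm_ring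
        rw [htrace (MT * MT * MF) hσ', hMM, Matrix.trace_sub, htrE]
  · -- `θ³ = −1`: `MT³ = −1`; apply §1 to `MT`
    have hTTT : ∀ Q : E₀.geomTorsion p, T (T (T Q)) = -Q := fun Q => Subtype.ext (by
      rw [hT, hT, hT, AddSubgroup.coe_neg, h3])
    have hM3 : MT * MT * MT = -1 := matrix_eq_of_forall_mulVec_eq fun w => by
      obtain ⟨Q, rfl⟩ := f.surjective w
      rw [← Matrix.mulVec_mulVec, ← Matrix.mulVec_mulVec, ← hfT, ← hfT, ← hfT, hTTT, map_neg, Matrix.neg_mulVec, Matrix.one_mulVec]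
    have hσ' : ∀ P : A.geomTorsion p, f' (σ • P) = (-(MT * MT * MF)) *ᵥ f' P := fun P => by
      have h6 : f' (σ • P) = -(MT *ᵥ (MT *ᵥ (MT *ᵥ f' (σ • P)))) := by
        rw [Matrix.mulVec_mulVec, Matrix.mulVec_mulVec, hM3, Matrix.neg_mulVec, Matrix.one_mulVec, neg_neg]
      rw [h6, h5, Matrix.mulVec_mulVec, Matrix.mulVec_mulVec, Matrix.neg_mulVec]
    rcases eq_neg_one_or_of_pow_three_eq_neg_one hM3 hnsq with hN | ⟨hN2, hNtr⟩
    · -- `MT = −1`: `σ` acts through `−MF`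
      left
      rw [← ZMod.intCast_zmod_eq_zero_iff_dvd]; push_cast
      rw [htrace _ hσ', hN, Matrix.trace_neg, neg_mul_neg, one_mul, one_mul, htrE]; ring
    · -- `MT² = MT − 1`: `σ` acts through `−(MT − 1) MF = MF − MT MF`, trace `t − x` with `x = tr(MT MF)`
      right
      have key := trace_identity_of_mul_self_eq_sub_one hN2 hNtr hnsq hMTF
      refine ⟨(MT * MF).trace, ?_, Or.inr ?_⟩
      · rw [← htrE, ← hdetE]; linear_combination key
      · have hMM : -(MT * MT * MF) = MF - MT * MF := by rw [hN2]; noncomm_ring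
        rw [htrace _ hσ', hMM, Matrix.trace_sub, htrE]; ring

/-! ## §5 The sextic door from point counts (record form) -/

/-- `Δ([0,0,0,0,1]) = −432 = −2⁴·3³`: a prime `≠ 2, 3` does not divide it. [folklore] -/
theorem not_dvd_discOf_E0' (ℓ : ℕ) (hℓ : ℓ.Prime) (hℓ2 : ℓ ≠ 2) (hℓ3 : ℓ ≠ 3) : ¬ (ℓ : ℤ) ∣ discOf [0, 0, 0, 0, 1] := by
  rw [show discOf [0, 0, 0, 0, 1] = -(2 ^ 4 * 3 ^ 3) by decide, dvd_neg]
  intro h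
  have hℓPi : Prime (ℓ : ℤ) := Nat.prime_iff_prime_int.mp hℓ
  rcases hℓPi.dvd_or_dvd h with h2 | h3
  · have h22 : ℓ ∣ 2 := by exact_mod_cast Int.Prime.dvd_pow' hℓ h2
    exact hℓ2 ((Nat.prime_dvd_prime_iff_eq hℓ Nat.prime_two).mp h22)
  · have h33 : ℓ ∣ 3 := by exact_mod_cast Int.Prime.dvd_pow' hℓ h3
    exact hℓ3 ((Nat.prime_dvd_prime_iff_eq hℓ Nat.prime_three).mp h33)

/-- **Sextic door from counts.** `V` (integral model `[a₁,…,a₆]`, globally minimal) is `p`-congruent (`p ≡ 2 (mod 3)`, `p ≥ 5`) to NO curve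
`A` with `j(A) = 0` as soon as one prime `ℓ ≡ 1 (mod 3)`, `ℓ ≠ p`, `ℓ ∤ Δ(V)` has, with `a = a_ℓ(V)` and `t = a_ℓ(E₀')` read off `countPoints`
(`E₀' = [0,0,0,0,1]`): `a² ≢ t² (mod p)` AND `a² ∉ {x², (x − t)²}` for every `x ∈ 𝔽_p` with `x² − tx + t² = 3ℓ` (a `decide` over `𝔽_p`).
[cite: SilvermanAEC2009, X.5 Prop. 5.4 (iii)] [cite: IrelandRosen1990, Ch. 18 §3 Thm. 4] -/
theorem not_modPCongruent_of_j_eq_zero_of_counts (V : WeierstrassCurve ℚ) [V.IsElliptic] [V.IsGloballyMinimal] (p : ℕ)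
    [Fact p.Prime] (hp3 : p % 3 = 2) (hp5 : 5 ≤ p) {a1 a2 a3 a4 a6 : ℤ} (hI : integralModelInt V = ⟨a1, a2, a3, a4, a6⟩)
    {A : WeierstrassCurve ℚ} [A.IsElliptic] (hj : A.j = 0)
    (ℓ : ℕ) [hℓ : Fact ℓ.Prime] (hℓ3 : ℓ % 3 = 1) (hℓp : ℓ ≠ p) (hΔ : ¬ (ℓ : ℤ) ∣ discOf [a1, a2, a3, a4, a6])
    (a t : ℤ) (ha : (ℓ : ℤ) + 1 - countPoints [a1, a2, a3, a4, a6] ℓ = a) (ht : (ℓ : ℤ) + 1 - countPoints [0, 0, 0, 0, 1] ℓ = t)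
    (h1 : ¬ (p : ℤ) ∣ a ^ 2 - t ^ 2)
    (h2 : ∀ x : ZMod p, x ^ 2 - (t : ZMod p) * x + (t : ZMod p) ^ 2 = 3 * (ℓ : ZMod p) →
      (a : ZMod p) ^ 2 ≠ x ^ 2 ∧ (a : ZMod p) ^ 2 ≠ (x - (t : ZMod p)) ^ 2) :
    ¬ ModPCongruent V A p := by
  intro hVA
  haveI : (⟨0, 0, 0, 0, 1⟩ : WeierstrassCurve ℚ).IsElliptic := isElliptic_cremona36a1
  haveI : (⟨0, 0, 0, 0, 1⟩ : WeierstrassCurve ℚ).IsGloballyMinimal := isGloballyMinimal_cremona36a1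
  have hℓ2 : ℓ ≠ 2 := by intro h; rw [h] at hℓ3; norm_num at hℓ3
  have hℓ3' : ℓ ≠ 3 := by intro h; rw [h] at hℓ3; norm_num at hℓ3
  obtain ⟨hgV, htV⟩ := EtaUncongruentRecords.good_and_frobeniusTrace_eq_of_countPoints hI ℓ hℓ2 hΔ
  have hIE : integralModelInt (⟨0, 0, 0, 0, 1⟩ : WeierstrassCurve ℚ) = ⟨0, 0, 0, 0, 1⟩ :=
    integralModelInt_eq_of_map_eq _ (map_mk_int 0 0 0 0 1)
  obtain ⟨-, htE⟩ := EtaUncongruentRecords.good_and_frobeniusTrace_eq_of_countPoints hIE ℓ hℓ2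
    (not_dvd_discOf_E0' ℓ hℓ.out hℓ2 hℓ3')
  rw [ha] at htV
  rw [ht] at htE
  rcases sq_frobeniusTrace_of_modPCongruent_of_j_eq_zero V p hp3 hp5 hVA hj ℓ hℓ3 hℓp hgV with h | ⟨x, hx, h⟩
  · exact h1 (by rw [← htV, ← htE]; exact h)
  · rw [htV] at h
    rw [htE] at h hx
    have := h2 x hx
    rcases h with h | h
    · exact this.1 h
    · exact this.2 h

/-! ## §5b The sextic door from point counts, integer form (appended, k8eta-c2 g16) -/

/-- **Sextic door from counts, integer form** (the record-ready variant of `not_modPCongruent_of_j_eq_zero_of_counts`: the door condition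
quantifies over `x < p` in `ℕ` with divisibilities in `ℤ`, so that a record discharges it by `decide` without any `ZMod p` instance in the
statement). `V` (integral model `[a₁,…,a₆]`, globally minimal) is `p`-congruent (`p ≡ 2 (mod 3)`, `p ≥ 5`) to NO curve `A` with `j(A) = 0`
as soon as one prime `ℓ ≡ 1 (mod 3)`, `ℓ ≠ p`, `ℓ ∤ Δ(V)` has, with `a = a_ℓ(V)` and `t = a_ℓ(E₀')` (`E₀' = [0,0,0,0,1]`): `p ∤ a² − t²`, and for
every `x < p` with `p ∣ x² − tx + t² − 3ℓ`: `p ∤ a² − x²` and `p ∤ a² − (x − t)²`.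
[cite: SilvermanAEC2009, X.5 Prop. 5.4 (iii)] [cite: IrelandRosen1990, Ch. 18 §3 Thm. 4] -/
theorem not_modPCongruent_of_j_eq_zero_of_counts_int (V : WeierstrassCurve ℚ) [V.IsElliptic] [V.IsGloballyMinimal] (p : ℕ)
    [Fact p.Prime] (hp3 : p % 3 = 2) (hp5 : 5 ≤ p) {a1 a2 a3 a4 a6 : ℤ} (hI : integralModelInt V = ⟨a1, a2, a3, a4, a6⟩)
    {A : WeierstrassCurve ℚ} [A.IsElliptic] (hj : A.j = 0)
    (ℓ : ℕ) [Fact ℓ.Prime] (hℓ3 : ℓ % 3 = 1) (hℓp : ℓ ≠ p) (hΔ : ¬ (ℓ : ℤ) ∣ discOf [a1, a2, a3, a4, a6])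
    (a t : ℤ) (ha : (ℓ : ℤ) + 1 - countPoints [a1, a2, a3, a4, a6] ℓ = a) (ht : (ℓ : ℤ) + 1 - countPoints [0, 0, 0, 0, 1] ℓ = t)
    (h1 : ¬ (p : ℤ) ∣ a ^ 2 - t ^ 2)
    (h2 : ∀ x : ℕ, x < p → (p : ℤ) ∣ (x : ℤ) ^ 2 - t * x + t ^ 2 - 3 * ℓ →
      ¬ (p : ℤ) ∣ a ^ 2 - (x : ℤ) ^ 2 ∧ ¬ (p : ℤ) ∣ a ^ 2 - ((x : ℤ) - t) ^ 2) :
    ¬ ModPCongruent V A p := by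
  refine not_modPCongruent_of_j_eq_zero_of_counts V p hp3 hp5 hI hj ℓ hℓ3 hℓp hΔ a t ha ht h1 fun x hx => ?_
  have hxv : (((x.val : ℕ) : ℤ) : ZMod p) = x := by rw [Int.cast_natCast, ZMod.natCast_zmod_val]
  have hrel : (p : ℤ) ∣ ((x.val : ℕ) : ℤ) ^ 2 - t * (x.val : ℕ) + t ^ 2 - 3 * ℓ := by
    rw [← ZMod.intCast_zmod_eq_zero_iff_dvd]; push_cast; rw [ZMod.natCast_zmod_val]; linear_combination hx
  obtain ⟨h3, h4⟩ := h2 x.val (ZMod.val_lt x) hrel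
  refine ⟨fun h => h3 ?_, fun h => h4 ?_⟩
  · rw [← ZMod.intCast_zmod_eq_zero_iff_dvd]; push_cast; rw [ZMod.natCast_zmod_val]; linear_combination h
  · rw [← ZMod.intCast_zmod_eq_zero_iff_dvd]; push_cast; rw [ZMod.natCast_zmod_val]; linear_combination h

end Summit.BirchSwinnertonDyer.BirchSwinnertonDyer.Theorems.EtaCartanField

end
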